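import Summits.NavierStokesRegularity.NavierStokesRegularity.Theses.RellichScar
import Summits.NavierStokesRegularity.NavierStokesRegularity.Theorems.ScarRigidity.Negative.LogicAndLoadBearing
import Literature.Analysis.FluidPDE.TypeIAncientMild
import Literature.Analysis.FluidPDE.ParasiticSlabFlow
import Summits.NavierStokesRegularity.NavierStokesRegularity.Theorems.RellichScarScarRigidityApexMildHelpers
import Summits.NavierStokesRegularity.NavierStokesRegularity.Theorems.RellichScarScarRigidityApexMildWindow
import Literature.Analysis.FluidPDE.KNSSRegularityGluing
import Literature.Analysis.FluidPDE.TaoQuantitativeTotalSpeed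
import HarnessLib

/-!
# `ScarRigidity` — line `finite-energy-log-convexity`, stub `stub_apexMildRepresentative`
# (crux stmt-NavierStokesRegularity-11717, route RellichScar)

**S1α — apex profiles are Type-I ancient mild solutions (Oseen/KNSS gauge).** A suitable weak
solution `u` on the slab `(-∞, 0) × ℝ³` with the apex bound `‖u(t,x)‖ ≤ C/(‖x‖ + √(-t))` has a
representative `V` (`V = u` a.e. on the slab) in the class `IsTypeIAncientMild C V` (jointly `C^∞`,
divergence free, Oseen–Duhamel formula between all pairs of times `s < t < 0`, Type-I rate) which
obeys the apex bound pointwise.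

Proof. On every window `(a, b)`, `b < 0`, `u` is bounded by `C/√(-b)`, hence a bounded weak
solution in the sense of KNSS 2009, §4 (ii) (`isBoundedWeakNSSolutionOn_window_of_apex`, helper
file 1), and `‖x‖‖u‖ ≤ C`; by helper file 2 (`exists_smooth_oseenMild_window`: Lemma 3.1, the
decay kills the parasitic drift, Prop. 4.1) it agrees a.e. on the window slab with a smooth
divergence-free Oseen-mild field (`exists_smooth_oseenMild_Ioo`, after a time translation). Two
such fields agree on the overlap of their windows (continuous and a.e. equal on an open set), so
the fields on the exhausting windows `(-(n+2), -1/(n+2))` patch to one field `V` on the slab; the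
apex bound transfers from `u` to the continuous `V` (a.e., then everywhere).
-/

noncomputable section

open Set Filter Function MeasureTheory Metric TopologicalSpace
open scoped Topology ENNReal NNReal InnerProductSpace RealInnerProductSpace
open Literature.Analysis.FluidPDE
open Summit.NavierStokesRegularity.NavierStokesRegularity.Theses.RellichScar
open Summit.NavierStokesRegularity.NavierStokesRegularity.Theorems.ScarRigidity.Negative

set_option linter.dupNamespace false

namespace Summit.NavierStokesRegularity.NavierStokesRegularity.Theorems.RellichScarScarRigidity

/-- Physical space. -/
local notation "ℝ³" => EuclideanSpace ℝ (Fin 3)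

/-- The open backward slab `(-∞,0) × ℝ³` (time first), as in the route file. -/
local notation "𝕊" => Literature.Analysis.FluidPDE.slab (EuclideanSpace ℝ (Fin 3)) (Set.Iio (0 : ℝ)) isOpen_Iio

open Literature.Analysis

/-! ## Smooth mild representatives on the windows `(a, b)`, `b < 0` -/

/-- **Smooth Oseen-mild representative of an apex profile on a window** `(a, b)`, `b < 0`: there
is `V`, jointly `C^∞` on `(a, b) × ℝ³`, divergence free, with
`V(t, x) = e^{(t−s)Δ}V(s)(x) − B¹_s(V,V)(t)(x)` for `a < s < t < b`, and `V = u` a.e. on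
`(a, b) × ℝ³` (helper files 1–2, after the time translation `τ = t − a`). [cite: KochNadirashviliSereginSverak2009, §4 Prop. 4.1, Lemma 3.1 and proof of Thm 6.1 (arXiv:0709.3599 pp. 7–8, 12)] -/
theorem exists_smooth_oseenMild_Ioo {u : ℝ → ℝ³ → ℝ³} {p : ℝ → ℝ³ → ℝ} {C a b : ℝ}
    (hsw : IsSuitableWeakSolutionOn 𝕊 1 0 u p) (hd : HasTypeIDecay C u) (hab : a < b) (hb : b < 0) :
    ∃ V : ℝ → ℝ³ → ℝ³, IsSmoothSpaceTimeOn (Ioo a b) V ∧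
      (∀ t ∈ Ioo a b, VectorCalculus.IsDivFree (V t)) ∧
      (∀ s t : ℝ, a < s → s < t → t < b → ∀ x,
        V t x = UnboundedOperators.heatExtension (V s) (t - s) x - oseenDuhamel 1 s V V t x) ∧
      uncurry V =ᵐ[volume.restrict (Ioo a b ×ˢ (univ : Set ℝ³))] uncurry u := by
  have hC : 0 ≤ C := nonneg_of_hasTypeIDecay hd
  obtain ⟨hbw, hK⟩ := isBoundedWeakNSSolutionOn_window_of_apex (a := a) hsw hd hb
  have hT0 : 0 < b - a := sub_pos.2 hab
  set w : ℝ → ℝ³ → ℝ³ := fun τ => u (τ + a) with hw_def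
  have hw : IsBoundedWeakNSSolutionOn (Ioo 0 (b - a)) isOpen_Ioo 1 w :=
    hbw.comp_add_right a isOpen_Ioo fun t => by
      simp only [mem_Ioo]
      constructor <;> intro h <;> constructor <;> linarith [h.1, h.2]
  have hL : ∀ τ ∈ Ioo 0 (b - a), ∀ y, ‖w τ y‖ ≤ C / Real.sqrt (-b) := fun τ hτ y =>
    hK (τ + a) ⟨by linarith [hτ.1], by linarith [hτ.2]⟩ y
  have hD : ∀ τ ∈ Ioo 0 (b - a), ∀ y, ‖y‖ * ‖w τ y‖ ≤ C := fun τ hτ y => by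
    have hτa : τ + a < 0 := by linarith [hτ.2]
    have h1 := hd (τ + a) hτa y
    have hden : 0 < ‖y‖ + Real.sqrt (-(τ + a)) :=
      add_pos_of_nonneg_of_pos (norm_nonneg _) (Real.sqrt_pos.2 (by linarith))
    calc ‖y‖ * ‖w τ y‖ ≤ ‖y‖ * (C / (‖y‖ + Real.sqrt (-(τ + a)))) :=
          mul_le_mul_of_nonneg_left h1 (norm_nonneg _)
      _ ≤ (‖y‖ + Real.sqrt (-(τ + a))) * (C / (‖y‖ + Real.sqrt (-(τ + a)))) :=
          mul_le_mul_of_nonneg_right (le_add_of_nonneg_right (Real.sqrt_nonneg _)) (by positivity)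
      _ = C := mul_div_cancel₀ C hden.ne'
  obtain ⟨V₀, hsm₀, hdiv₀, hmild₀, hae₀⟩ := exists_smooth_oseenMild_window hT0 hw hL hD
  set V : ℝ → ℝ³ → ℝ³ := fun t => V₀ (t - a) with hVdef
  have hV₀ : V₀ = fun τ => V (τ + a) := by
    funext τ
    simp only [hVdef, add_sub_cancel_right]
  refine ⟨V, ?_, fun t ht => hdiv₀ (t - a) ⟨by linarith [ht.1], by linarith [ht.2]⟩,
    fun s t has hst htb x => ?_, ?_⟩
  · -- joint smoothness along `(t, x) ↦ (t - a, x)`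
    have hmap : ContDiff ℝ ((⊤ : ℕ∞) : WithTop ℕ∞) fun q : ℝ × ℝ³ => (q.1 - a, q.2) :=
      (contDiff_fst.sub contDiff_const).prodMk contDiff_snd
    have hinto : MapsTo (fun q : ℝ × ℝ³ => (q.1 - a, q.2)) (Ioo a b ×ˢ univ)
        (Ioo 0 (b - a) ×ˢ univ) := by
      rintro ⟨t, x⟩ ⟨ht, -⟩
      exact ⟨⟨by linarith [ht.1], by linarith [ht.2]⟩, mem_univ _⟩
    exact hsm₀.comp hmap.contDiffOn hinto
  · -- the Oseen integral equation, translated in time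
    have h := hmild₀ (s - a) (t - a) (by linarith) (by linarith) (by linarith) x
    rw [show t - a - (s - a) = t - s by ring] at h
    calc V t x = V₀ (t - a) x := rfl
      _ = UnboundedOperators.heatExtension (V₀ (s - a)) (t - s) x -
            oseenDuhamel 1 (s - a) V₀ V₀ (t - a) x := h
      _ = UnboundedOperators.heatExtension (V s) (t - s) x - oseenDuhamel 1 s V V t x := by
          congr 1
          conv_lhs => rw [hV₀]
          rw [oseenDuhamel_translate, sub_add_cancel, sub_add_cancel]
  · -- a.e. equality on the window slab, along `(t, x) ↦ (t - a, x)`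
    have he : MeasurePreserving (Prod.map (fun t : ℝ => t - a) (id : ℝ³ → ℝ³))
        (volume : Measure (ℝ × ℝ³)) volume := by
      have := (measurePreserving_sub_right (volume : Measure ℝ) a).prod
        (MeasurePreserving.id (volume : Measure ℝ³))
      rwa [← Measure.volume_eq_prod] at this
    have hpre : (Prod.map (fun t : ℝ => t - a) (id : ℝ³ → ℝ³)) ⁻¹' (Ioo 0 (b - a) ×ˢ (univ : Set ℝ³)) =
        Ioo a b ×ˢ univ := by
      ext q
      simp only [mem_preimage, Prod.map, id, mem_prod, mem_Ioo, mem_univ, and_true]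
      constructor <;> intro h <;> constructor <;> linarith [h.1, h.2]
    have he' := he.restrict_preimage (measurableSet_Ioo.prod MeasurableSet.univ)
      (s := Ioo 0 (b - a) ×ˢ (univ : Set ℝ³))
    rw [hpre] at he'
    have h2 := he'.quasiMeasurePreserving.ae_eq_comp hae₀
    refine h2.trans (Eventually.of_forall fun q => ?_)
    simp only [comp_apply, Prod.map, uncurry, hw_def, id, sub_add_cancel]

/-! ## The stub -/

/-- **S1α — apex profiles are Type-I ancient mild solutions (Oseen/KNSS gauge).**  A suitable weak
solution on the slab with `𝐈 < ∞` and the apex bound `‖u‖ ≤ C/(‖x‖+√−t)` has a representative `V`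
(`V = u` a.e. on the slab) which is jointly smooth on the open slab, divergence free, satisfies the
Oseen–Duhamel formula between all pairs of times `s < t < 0`, and obeys the same apex bound pointwise.
Sources: KNSS 2009 §4 (bounded weak solutions are mild modulo a parasitic drift `b(t)`; the spatial decay
forces `b = 0`), Prop. 4.1 (smoothing); the smooth representatives on the exhausting windows
`(-(n+2), -1/(n+2))` agree on overlaps and patch; the apex bound passes from `u` to the continuous
`V`. (`𝐈 < ∞` and the weak gradient are not used.) [cite: KochNadirashviliSereginSverak2009, §4 Prop. 4.1, Lemma 3.1 and proof of Thm 6.1 (arXiv:0709.3599 pp. 7–8, 12)] -/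
theorem stub_apexMildRepresentative :
    ∀ (u : ℝ → ℝ³ → ℝ³) (p : ℝ → ℝ³ → ℝ) (G : ℝ → ℝ³ → ℝ³ →L[ℝ] ℝ³) (C : ℝ), 0 < C →
      IsSuitableWeakSolutionOn 𝕊 1 0 u p → HasWeakSpatialGradientOn 𝕊 u G →
      typeIBound (Iio (0 : ℝ) ×ˢ univ) u p G < ⊤ → HasTypeIDecay C u →
      ∃ V : ℝ → ℝ³ → ℝ³,
        uncurry V =ᵐ[volume.restrict (Iio (0 : ℝ) ×ˢ (univ : Set ℝ³))] uncurry u ∧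
        IsTypeIAncientMild C V ∧ HasTypeIDecay C V := by
  intro u p G C hC hsw _ _ hd
  -- the exhausting windows `(-(n+2), -1/(n+2))`
  set aW : ℕ → ℝ := fun n => -((n : ℝ) + 2) with haW
  set bW : ℕ → ℝ := fun n => -(1 / ((n : ℝ) + 2)) with hbW
  have hpos : ∀ n : ℕ, (0 : ℝ) < (n : ℝ) + 2 := fun n => by positivity
  have hb : ∀ n, bW n < 0 := fun n => by
    simp only [hbW, neg_lt_zero]
    exact one_div_pos.2 (hpos n)
  have hab : ∀ n, aW n < bW n := fun n => by
    have h1 : 1 / ((n : ℝ) + 2) ≤ 1 := by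
      rw [div_le_one (hpos n)]
      linarith
    simp only [haW, hbW]
    linarith
  choose Vn hsm hdiv hmild hae using fun n => exists_smooth_oseenMild_Ioo hsw hd (hab n) (hb n)
  -- every `t < 0` lies in the window of index `ι t`
  set ι : ℝ → ℕ := fun t => ⌈max (-t) (1 / (-t))⌉₊ with hι
  have hmem : ∀ t < 0, t ∈ Ioo (aW (ι t)) (bW (ι t)) := by
    intro t ht
    have h1 : max (-t) (1 / (-t)) ≤ (ι t : ℝ) := Nat.le_ceil _
    have hnt : -t ≤ (ι t : ℝ) := (le_max_left _ _).trans h1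
    have hit : 1 / (-t) ≤ (ι t : ℝ) := (le_max_right _ _).trans h1
    refine ⟨by simp only [haW]; linarith, ?_⟩
    have h2 : 1 / (-t) < (ι t : ℝ) + 2 := by linarith
    have h3 : 1 / ((ι t : ℝ) + 2) < -t := by
      rw [div_lt_iff₀ (hpos _)]
      have := (div_lt_iff₀ (neg_pos.2 ht)).1 h2
      linarith
    simp only [hbW]
    linarith
  -- the windows increase
  have hsubW : ∀ {m n : ℕ}, m ≤ n → Ioo (aW m) (bW m) ⊆ Ioo (aW n) (bW n) := fun {m n} h => by
    have hc := (Nat.cast_le (α := ℝ)).2 h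
    refine Ioo_subset_Ioo (by simp only [haW]; linarith) ?_
    simp only [hbW, neg_le_neg_iff]
    exact one_div_le_one_div_of_le (hpos m) (by linarith)
  -- two window fields agree on the overlap
  have hcons : ∀ m n, ∀ t ∈ Ioo (aW m) (bW m), t ∈ Ioo (aW n) (bW n) → ∀ x, Vn m t x = Vn n t x := by
    suffices H : ∀ m n, m ≤ n → ∀ t ∈ Ioo (aW m) (bW m), ∀ x, Vn m t x = Vn n t x by
      intro m n t htm htn x
      rcases le_total m n with h | h
      · exact H m n h t htm x
      · exact (H n m h t htn x).symm
    intro m n hmn t ht x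
    have hO : IsOpen (Ioo (aW m) (bW m) ×ˢ (univ : Set ℝ³)) := isOpen_Ioo.prod isOpen_univ
    have hcm : ContinuousOn (uncurry (Vn m)) (Ioo (aW m) (bW m) ×ˢ univ) := (hsm m).continuousOn
    have hcn : ContinuousOn (uncurry (Vn n)) (Ioo (aW m) (bW m) ×ˢ univ) :=
      (hsm n).continuousOn.mono (prod_mono (hsubW hmn) Subset.rfl)
    have haen : uncurry (Vn n) =ᵐ[volume.restrict (Ioo (aW m) (bW m) ×ˢ (univ : Set ℝ³))]
        uncurry u :=
      ae_restrict_of_ae_restrict_of_subset (prod_mono (hsubW hmn) Subset.rfl) (hae n)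
    have haemn : uncurry (Vn m) =ᵐ[volume.restrict (Ioo (aW m) (bW m) ×ˢ (univ : Set ℝ³))]
        uncurry (Vn n) := (hae m).trans haen.symm
    exact Measure.eqOn_open_of_ae_eq haemn hO hcm hcn (mk_mem_prod ht (mem_univ x))
  -- the patched field
  set V : ℝ → ℝ³ → ℝ³ := fun t x => Vn (ι t) t x with hV
  have hVeq : ∀ n, ∀ t ∈ Ioo (aW n) (bW n), V t = Vn n t := fun n t ht => by
    funext x
    exact hcons (ι t) n t (hmem t (ht.2.trans (hb n))) ht x
  -- `V = u` a.e. on the slab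
  have haeV : uncurry V =ᵐ[volume.restrict (Iio (0 : ℝ) ×ˢ (univ : Set ℝ³))] uncurry u := by
    have hU : Iio (0 : ℝ) ×ˢ (univ : Set ℝ³) = ⋃ n : ℕ, Ioo (aW n) (bW n) ×ˢ (univ : Set ℝ³) := by
      ext ⟨t, x⟩
      simp only [mem_prod, mem_Iio, mem_univ, and_true, mem_iUnion]
      exact ⟨fun ht => ⟨ι t, hmem t ht⟩, fun ⟨n, hn⟩ => hn.2.trans (hb n)⟩
    rw [hU]
    refine (ae_restrict_iUnion_iff _ _).2 fun n => ?_
    filter_upwards [hae n, ae_restrict_mem (measurableSet_Ioo.prod MeasurableSet.univ)] with q hq hqO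
    rw [← hq]
    show V q.1 q.2 = Vn n q.1 q.2
    rw [hVeq n q.1 hqO.1]
  -- the apex bound passes to the continuous representative
  have hdecV : HasTypeIDecay C V := by
    intro t ht x
    have htW := hmem t ht
    have hO : IsOpen (Ioo (aW (ι t)) (bW (ι t)) ×ˢ (univ : Set ℝ³)) := isOpen_Ioo.prod isOpen_univ
    have hf : ContinuousOn (fun q : ℝ × ℝ³ => ‖Vn (ι t) q.1 q.2‖) (Ioo (aW (ι t)) (bW (ι t)) ×ˢ univ) :=
      (hsm (ι t)).continuousOn.norm
    have hg : ContinuousOn (fun q : ℝ × ℝ³ => C / (‖q.2‖ + Real.sqrt (-q.1)))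
        (Ioo (aW (ι t)) (bW (ι t)) ×ˢ univ) := by
      refine continuousOn_const.div (Continuous.continuousOn (by fun_prop)) fun q hq => ?_
      have : 0 < Real.sqrt (-q.1) := Real.sqrt_pos.2 (by linarith [hq.1.2, hb (ι t)])
      positivity
    have haemin : (fun q : ℝ × ℝ³ => ‖Vn (ι t) q.1 q.2‖ ⊓ (C / (‖q.2‖ + Real.sqrt (-q.1)))) =ᵐ[
        volume.restrict (Ioo (aW (ι t)) (bW (ι t)) ×ˢ (univ : Set ℝ³))]
        fun q => ‖Vn (ι t) q.1 q.2‖ := by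
      filter_upwards [hae (ι t), ae_restrict_mem (measurableSet_Ioo.prod MeasurableSet.univ)]
        with q hq hqO
      have hq' : Vn (ι t) q.1 q.2 = u q.1 q.2 := hq
      rw [hq']
      exact inf_eq_left.2 (hd q.1 (hqO.1.2.trans (hb (ι t))) q.2)
    have heq := Measure.eqOn_open_of_ae_eq haemin hO (hf.inf hg) hf (mk_mem_prod htW (mem_univ x))
    have hVt : V t x = Vn (ι t) t x := rfl
    rw [hVt]
    exact inf_eq_left.1 heq
  -- joint smoothness (local), divergence, Oseen equation, rate
  have hcont : ContDiffOn ℝ (⊤ : ℕ∞) (uncurry V) (Iio 0 ×ˢ univ) := by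
    refine contDiffOn_of_locally_contDiffOn ?_
    rintro ⟨t, x⟩ ⟨ht, -⟩
    have ht' : t < 0 := ht
    refine ⟨Ioo (aW (ι t)) (bW (ι t)) ×ˢ univ, isOpen_Ioo.prod isOpen_univ, ⟨hmem t ht', mem_univ _⟩,
      ?_⟩
    have hsmt : ContDiffOn ℝ (⊤ : ℕ∞) (uncurry (Vn (ι t))) (Ioo (aW (ι t)) (bW (ι t)) ×ˢ univ) :=
      hsm (ι t)
    refine (hsmt.mono inter_subset_right).congr ?_
    rintro ⟨τ, y⟩ ⟨-, hτ, -⟩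
    show V τ y = Vn (ι t) τ y
    rw [hVeq (ι t) τ hτ]
  have hmildV : ∀ s t : ℝ, s < t → t < 0 → ∀ x,
      V t x = heatFlow (V s) (t - s) x - oseenDuhamel 1 s V V t x := by
    intro s t hst ht x
    have hs : s < 0 := hst.trans ht
    have hsW : s ∈ Ioo (aW (max (ι s) (ι t))) (bW (max (ι s) (ι t))) :=
      hsubW (le_max_left _ _) (hmem s hs)
    have htW : t ∈ Ioo (aW (max (ι s) (ι t))) (bW (max (ι s) (ι t))) :=
      hsubW (le_max_right _ _) (hmem t ht)
    rw [heatFlow_of_pos _ (sub_pos.2 hst), hVeq _ t htW, hVeq _ s hsW,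
      hmild (max (ι s) (ι t)) s t hsW.1 hst htW.2 x]
    congr 1
    refine oseenDuhamel_congr_Ioo (fun τ hτ => ?_) (fun τ hτ => ?_) x <;>
      exact (hVeq _ τ ⟨hsW.1.trans hτ.1, hτ.2.trans htW.2⟩).symm
  refine ⟨V, haeV, ⟨hcont, fun t ht => ?_, hmildV, hdecV.hasTypeITimeDecay hC.le⟩, hdecV⟩
  rw [hVeq (ι t) t (hmem t ht)]
  exact hdiv (ι t) t (hmem t ht)

end Summit.NavierStokesRegularity.NavierStokesRegularity.Theorems.RellichScarScarRigidity

end
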